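import Summits.ABC.StewartYu.KummerThirdDoor
import Summits.ABC.StewartYu.Y07OfYu2007
import Literature.NumberTheory.DiophantineGeometry.AbcStewartYu2001KummerPlaceBoundsProofs
import HarnessLib

/-!
# Cell abc-stewartyu, rung A1.M3⁺: Stewart–Yu 2001, Theorem 2 from the two Gen-3 crux texts `Y07Odd` / `Y07Two`

`Summits/ABC/StewartYu/StewartYu2001ThmTwoOfY07.lean` — cell `abc-stewartyu` (literature seat lit g6; theorems only, no
named fact).  The CLOSER of the Thm-2 door: the Literature theorem
`StewartYu2001.stewartYu2001_thm2_of_placeBounds_kummerArchBound₂`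
(`Literature/NumberTheory/DiophantineGeometry/AbcStewartYu2001KummerPlaceBoundsProofs.lean`, = the body of the staged
door statement `ThmTwo.ThmTwoDoor` of lit g5 / plan g7's `ThmTwoDoorPlaceBounds`) takes the two `p`-adic PLACE BOUNDS
(p ∣ a), (p ∣ c) of Yu-2007 quality, the `E = 2` Kummer-conditional archimedean binder `hW₂` with constants `Cw` of
class `(c₀ n)ⁿ`; here `Cw := w80Cw` (`= (2⁷⁰ n)ⁿ`, `w80Cw_le`), `hW₂ := waldschmidt1980_hW₂` (the tree's PROVED
Waldschmidt 1980 Prop. 3.8 over `ℚ`), and the place bounds come from the crux texts through p3's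
`KummerThird.y07At_of_odd_two` / `placeBound_a_of_y07At` / `placeBound_c_of_y07At` — plumbing identical to
`KummerThird.BakerMethodBounds_of_y07` (the A1.M3 door).  Results:

* `ThmTwo.stewartYu2001_thm2_of_placeBounds₂` — Theorem 2 from the two `p`-adic place bounds ALONE (archimedean side
  discharged by the tree);
* `ThmTwo.stewartYu2001_thm2_of_y07At` — from the merged text `∀ p, Y07At C p`;
* `ThmTwo.stewartYu2001_thm2_of_y07` — **`⟨Y07Odd⟩ → ⟨Y07Two⟩ → stewartYu2001_thm2`**: the support `ThmTwoDoor` of the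
  staged rung route `PadicPrimesGroupedSubpower` (HOME/plan/m3plus/), whose cruxes are the A1.M3 cruxes verbatim;
* `ThmTwo.stewartYu2001_thm2_of_yu2007` — a second trust path for the named fact `stewartYu2001_thm2`: it follows from
  the ONE primary `p`-adic fact `Literature.Barriers.ABC.yu2007_padicLogForm_rat` (Yu 2007 over `ℚ`, via lit g5's
  `Y07.y07Odd/Two_of_yu2007`), the archimedean side being the tree's PROVED Waldschmidt 1980 — compare lit-abc-sy2001's
  `StewartYu2001.stewartYu2001_thm2_of_matveev_yu` (Matveev 2000 AND Yu 2007).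

So `stewartYu2001_thm2` (A1.M3⁺, `log z < p′ · G^{c log₃ G⋆ / log₂ G}`) closes in the kernel the minute the two A1.M3
cruxes `Y07Odd` (stmt-ABC-19658) / `Y07Two` (stmt-ABC-19659) close — NO further transcendence input.
WHAT THIS IS NOT: the crux texts are hypotheses here; nothing about the Gen-3 `p`-adic engine is proved.
[cite: StewartYu2001, Theorem 2] [cite: Waldschmidt1980, Prop 3.8]
-/

noncomputable section

open Finset Real Height
open Literature.NumberTheory.DiophantineGeometry
open Literature.NumberTheory.DiophantineGeometry.Dioph
open Literature.NumberTheory.DiophantineGeometry.Pasten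
open Literature.NumberTheory.DiophantineGeometry.StewartYu2001
open Literature.NumberTheory.Transcendental.Waldschmidt1980
open Literature.Barriers.ABC

namespace Summit.ABC.StewartYu.ThmTwo

/-- **Stewart–Yu 2001, Theorem 2, from the two `p`-adic place bounds alone** (`K ≥ 1`; (p ∣ a) and (p ∣ c, `ab > 1`)
of Yu-2007 quality): the archimedean side of the door `stewartYu2001_thm2_of_placeBounds_kummerArchBound₂` is the
tree's theorem `waldschmidt1980_hW₂` with `Cw = w80Cw = (2⁷⁰ n)ⁿ`. [cite: StewartYu2001, Theorem 2]
[cite: Waldschmidt1980, Prop 3.8] -/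
theorem stewartYu2001_thm2_of_placeBounds₂ {K : ℝ} (hK : 1 ≤ K)
    (hpad : ∀ {a b c : ℕ}, IsABCTriple a b c → ∀ {p : ℕ}, p.Prime → p ∣ a →
      (a.factorization p : ℝ) * Real.log p < theta K b c 0 *
        ((p / Real.log p) * (Real.log p + Real.log (max (Real.exp 1) (2 * Real.log c)))))
    (hpadc : ∀ {a b c : ℕ}, IsABCTriple a b c → 1 < a * b → ∀ {p : ℕ}, p.Prime → p ∣ c →
      (c.factorization p : ℝ) * Real.log p < theta K a b 0 *
        ((p / Real.log p) * (Real.log p + Real.log (max (Real.exp 1) (2 * Real.log c))))) :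
    stewartYu2001_thm2 :=
  stewartYu2001_thm2_of_placeBounds_kummerArchBound₂ hK hpad hpadc w80Cw w80Cw_nonneg
    ⟨2 ^ 70, fun n => w80Cw_le n⟩ waldschmidt1980_hW₂

/-- **Theorem 2 from the merged prime-class text `∀ p, Y07At C p`** (`C ≥ 0`): `K := max 4 C`, place bounds by
`KummerThird.placeBound_a_of_y07At` / `placeBound_c_of_y07At`. [cite: StewartYu2001, Theorem 2 and §3] -/
theorem stewartYu2001_thm2_of_y07At {C : ℝ} (hC0 : 0 ≤ C) (hY : ∀ p : ℕ, p.Prime → KummerThird.Y07At C p) :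
    stewartYu2001_thm2 :=
  stewartYu2001_thm2_of_placeBounds₂ (K := max 4 C) (le_trans (by norm_num) (le_max_left _ _))
    (fun h _ hp hpa => KummerThird.placeBound_a_of_y07At hC0 h hp (hY _ hp) hpa)
    (fun h h1 _ hp hpc => KummerThird.placeBound_c_of_y07At hC0 h h1 hp (hY _ hp) hpc)

/-- **Stewart–Yu 2001 Theorem 2 from the two crux texts `Y07Odd` / `Y07Two`** (support `ThmTwoDoor` of the staged rung
route `PadicPrimesGroupedSubpower`; the texts are those of the A1.M3 cruxes stmt-ABC-19658 / 19659 VERBATIM, as in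
`KummerThird.BakerMethodBounds_of_y07`). [cite: StewartYu2001, Theorem 2] [cite: Waldschmidt1980, Prop 3.8] -/
theorem stewartYu2001_thm2_of_y07
    (hOdd : ∃ c₆ : ℝ, ∀ (p : ℕ), p.Prime → p ≠ 2 → ∀ (S : Finset ℕ), (∀ q ∈ S, q.Prime) → p ∉ S → S.Nonempty →
      ∀ (e : ℕ → ℤ) (B : ℝ), 3 ≤ B → (∀ q ∈ S, (|e q| : ℝ) ≤ B) →
      ∏ q ∈ S, (q : ℚ) ^ e q ≠ 1 →
      (padicValRat p (∏ q ∈ S, (q : ℚ) ^ e q - 1) : ℝ) * Real.log p <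
        c₆ ^ S.card * ((p : ℝ) / Real.log p) *
          (Real.log p + Real.log B + Real.log (Real.log ((max 4 (S.sup id) : ℕ) : ℝ))) *
          ∏ q ∈ S, Real.log (q : ℝ))
    (hTwo : ∃ c₆ : ℝ, ∀ (S : Finset ℕ), (∀ q ∈ S, q.Prime) → 2 ∉ S → S.Nonempty →
      ∀ (e : ℕ → ℤ) (B : ℝ), 3 ≤ B → (∀ q ∈ S, (|e q| : ℝ) ≤ B) →
      ∏ q ∈ S, (q : ℚ) ^ e q ≠ 1 →
      (padicValRat 2 (∏ q ∈ S, (q : ℚ) ^ e q - 1) : ℝ) * Real.log 2 <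
        c₆ ^ S.card * ((2 : ℝ) / Real.log 2) *
          (Real.log 2 + Real.log B + Real.log (Real.log ((max 4 (S.sup id) : ℕ) : ℝ))) *
          ∏ q ∈ S, Real.log (q : ℝ)) :
    stewartYu2001_thm2 := by
  obtain ⟨C, hC0, hY⟩ := KummerThird.y07At_of_odd_two hOdd hTwo
  exact stewartYu2001_thm2_of_y07At hC0 hY

/-- **Stewart–Yu 2001 Theorem 2 from Yu's `p`-adic theorem over `ℚ` alone** (the named fact
`Literature.Barriers.ABC.yu2007_padicLogForm_rat` = Evertse–Győry Thm 3.2.7 over `ℚ`): the crux texts follow from it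
(`Y07.y07Odd_of_yu2007`, `Y07.y07Two_of_yu2007`), the archimedean input is the tree's theorem `waldschmidt1980_hW₂`.
So the trust base of `stewartYu2001_thm2` in the tree is now `{yu2007_padicLogForm_rat}` (one primary fact).
[cite: StewartYu2001, Theorem 2] [cite: EvertseGyory2015, Thm 3.2.7 (p. 62)] [cite: Waldschmidt1980, Prop 3.8] -/
theorem stewartYu2001_thm2_of_yu2007 (h : yu2007_padicLogForm_rat) : stewartYu2001_thm2 :=
  stewartYu2001_thm2_of_y07 (Y07.y07Odd_of_yu2007 h) (Y07.y07Two_of_yu2007 h)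

end Summit.ABC.StewartYu.ThmTwo

end
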